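import Summits.BirchSwinnertonDyer.BirchSwinnertonDyer.Theorems.GenusKolyvaginAtTwoGenusPrimitiveSupplyAtTwoTwoTranspositionIff
import HarnessLib

/-!
# Route `GenusKolyvaginAtTwo`, crux #2 `GenusPrimitiveSupplyAtTwo` (stmt-BirchSwinnertonDyer-22136):
# THE CELL'S `F1Sign2.TwoDoor.TwoTranspositionBitLawAtTwo` IS A THEOREM — ONE bit-function `b` per curve predicts the `Sel₂`-triviality of
# EVERY two-transposition twist: `Sel₂(W^{(d)}) = 0 ⟺ p_{q₀} b_{q₁} + p_{q₁} b_{q₀} = 1`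

Width seat `bsd-line-gk2-p4` g14 (cell `bsd-f1-sign2`), sequel of `…TwoTranspositionIff` (the quadratic `iff` of T-2q in frame currency, p669774).
THEOREMS ONLY; helper `--supports stmt-BirchSwinnertonDyer-22136`; no item is closed; BSD is not proved by any of this.

WHAT. `TwoTranspositionBitLawAtTwo` (-an g9, MEMO-an v1.19 §2 AN-26, typed by -ty g7; «THEOREM on paper, the elementary shadow of T-2q; the census
dictionary», ENGINE J 5 293/5 293 curves, 176 403 redundant predictions met): for every globally minimal `W` with `Δ > 0`, `E(ℚ)[2] = 0`, rank `1`,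
`Ш[2] = 0`, `E(ℚ) ⊂ E⁰(ℝ)` there is ONE predicate `b` on primes such that for EVERY two-transposition-admissible `(d, q₀, q₁)`:
`#Sel₂(W^{(d)}) = 1 ↔ Xor (door open at q₀ ∧ b q₁) (door open at q₁ ∧ b q₀)`.
**`twoTranspositionBitLaw_holds : TwoTranspositionBitLawAtTwo`.**

PROOF. The ∞-relaxed group `R = H¹_{kummerRelaxed {∞}}` contains `Sel₂(W) = {0, c_door}` with index `#𝓛_∞ = 2` (archimedean Kummer count,
Poitou–Tate inputs discharged; `Sel₂(W)` is strict at `∞` since `E(ℚ) ⊂ E⁰(ℝ)`), so `R = {0, c_door, c_∞, c_∞ + c_door}` for ANY `c_∞ ∈ R ∖ Sel₂(W)`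
(`AddSubgroup.relIndex_eq_two_iff`); put `b q := loc_q c_∞ ≠ 0` (`c_∞` chosen once; the other choice `c_∞ + c_door` flips `b` by the door bits,
as the docstring of the law says). At a door prime the local Kummer line is `{0, k}`, `loc c_door = p·k`, `loc c_∞ = b·k`. By the quadratic `iff`
(`twoTranspositionTwistLaw_iff_strict`), with a door open `#Sel₂(W^{(d)}) = 1` iff no non-zero element of `R` vanishes at both door places, i.e. iff
`p ≠ 0`, `b ≠ 0` and `p ≠ b` in `𝔽₂²`, i.e. iff `p₀b₁ + p₁b₀ = 1`; with both doors shut both sides are false (counting half `#Sel₂ ∈ {4, 16}`).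

References: [MazurRubin2010] Def. 3.1, Lemma 3.2, Prop. 3.3 (method); [PoonenRains2012] Thm. 4.14; [KlagsbrunMazurRubin2014] Prop. 47 (ii).
-/

set_option linter.dupNamespace false -- tree convention: `Summit.BirchSwinnertonDyer.BirchSwinnertonDyer.Theorems` (summit = sub-problem)
set_option autoImplicit false

noncomputable section

open scoped Classical ContRepresentation

namespace Summit.BirchSwinnertonDyer.BirchSwinnertonDyer.Theorems.GenusKolyTransp

open WeierstrassCurve Field NumberField IsDedekindDomain Function
open Literature.NumberTheory.EllipticCurves Literature.NumberTheory.GaloisRepresentations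
open Literature.NumberTheory.GaloisRepresentations.DiscreteGaloisModule (SelmerStructure)
open Literature.NumberTheory.GaloisCohomology
open Rat.HeightOneSpectrum (primesEquiv natGenerator)
open Summit.BirchSwinnertonDyer.Rank1Residual.F1Sign2
open Summit.BirchSwinnertonDyer.Rank1Residual.F1Sign2.TranspositionDoor (MeetsNonNormAt)
open Summit.BirchSwinnertonDyer.Rank1Residual.F1Sign2.TwoDoor (TwoTranspAdmissible TwoTranspositionBitLawAtTwo)
open Summit.BirchSwinnertonDyer.Rank1Residual.X11b
open Summit.BirchSwinnertonDyer.Rank1Residual.X11b.KummerPT (kummerRelaxed kummerStrict kummerRelaxed_of_mem kummerRelaxed_of_not_mem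
  kummerStrict_of_mem kummerStrict_of_not_mem)
open Summit.BirchSwinnertonDyer.BirchSwinnertonDyer.Theorems.GenusKolyArch
open Summit.BirchSwinnertonDyer.BirchSwinnertonDyer.Theorems.GenusKolyTwistLocal (natCard_quotient_span_natCast_eq_one_of_not_mem)
open Summit.BirchSwinnertonDyer.BirchSwinnertonDyer.Theorems.GenusKolyTwistingPrime (primesEquiv_eq)
open Summit.BirchSwinnertonDyer.BirchSwinnertonDyer.Theorems.SchneiderFreeAdditiveX3.PoitouTateReduction
  (poitouTate_selmerStructure_duality_real_holds)
open Summit.BirchSwinnertonDyer.Rank1Residual.GaloisImage.EP (forall_localEulerPoincareCharacteristic_adicCompletion)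

/-! ## §26 Propositional form of «`p`, `b` linearly independent in `𝔽₂²`» -/

/-- `p ≠ 0 ∧ b ≠ 0 ∧ p ≠ b` in `𝔽₂²`, written on the four bits, is `p₀b₁ + p₁b₀ = 1`. [folklore] -/
theorem xor_and_iff_independent (P₀ P₁ B₀ B₁ : Prop) :
    (¬ (¬ P₀ ∧ ¬ P₁) ∧ ¬ (¬ B₀ ∧ ¬ B₁) ∧ ¬ ((B₀ ↔ P₀) ∧ (B₁ ↔ P₁))) ↔ Xor (P₀ ∧ B₁) (P₁ ∧ B₀) := by
  by_cases h₀ : P₀ <;> by_cases h₁ : P₁ <;> by_cases k₀ : B₀ <;> by_cases k₁ : B₁ <;> simp [Xor, h₀, h₁, k₀, k₁]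

/-! ## §27 The bit law -/

/-- **`F1Sign2.TwoDoor.TwoTranspositionBitLawAtTwo` HOLDS.** For every globally minimal elliptic `W/ℚ` with `Δ > 0`, `E(ℚ)[2] = 0`, rank `1`,
`Ш(W)[2] = 0`, `E(ℚ) ⊂ E⁰(ℝ)` there is ONE predicate `b` on primes (the local bits of a class `c_∞` of the ∞-relaxed `2`-Selmer group off `Sel₂(W)`)
such that for every two-transposition-admissible `(d, q₀, q₁)`: `#Sel₂(W^{(d)}) = 1 ↔ Xor (door open at q₀ ∧ b q₁) (door open at q₁ ∧ b q₀)`.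
[cite: MazurRubin2010, Lemma 3.2 and Prop. 3.3] [cite: PoonenRains2012, Thm. 4.14] [cite: KlagsbrunMazurRubin2014, Prop. 47 (ii)] -/
theorem twoTranspositionBitLaw_holds : TwoTranspositionBitLawAtTwo := by
  intro W _ _ _ hΔ hT hrank hSha hegg
  haveI : Fact (Nat.Prime 2) := ⟨Nat.prime_two⟩
  -- the Kummer structure, `Sel₂(W) = {0, g₀}`, strict at `∞`
  let 𝓚 : SelmerStructure (W.torsionGaloisModule ((2 : ℕ) : ℤ)) := W.kummerSelmerStructure ((2 : ℕ) : ℤ)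
  have h𝓚 : ∀ v, 𝓚 v = W.kummerSelmerStructure ((2 : ℕ) : ℤ) v := fun _ ↦ rfl
  set w₀ : InfinitePlace ℚ := Rat.infinitePlace with hw₀def
  have hw₀ : w₀.IsReal := Rat.isReal_infinitePlace
  have hΔ' : 0 < InfinitePlace.embedding_of_isReal hw₀ W.Δ := by rwa [embedding_of_isReal_rat_apply, Rat.cast_pos]
  have hSelW : Nat.card (W.selmerGroup ((2 : ℕ) : ℤ)) = 2 := by
    rw [Nat.cast_ofNat]
    exact selmerTwoCard_eq_two_of_rank_one W hT hrank hSha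
  have hSelK' : Nat.card 𝓚.selmerGroup = Nat.card (W.selmerGroup ((2 : ℕ) : ℤ)) := by
    rw [selmerGroup_eq_selmerGroup_kummerSelmerStructure]
    rfl
  have hSelK : Nat.card 𝓚.selmerGroup = 2 := hSelK'.trans hSelW
  obtain ⟨g₀, hg₀, hg₀0, hKel⟩ := exists_ne_zero_of_natCard_eq_two 𝓚.selmerGroup hSelK
  have hstrictinf := forall_mem_selmerGroup_localization_inl_eq_zero_of_not_meetsEgg W hΔ hT hSha hegg
  have hKinl : Nat.card (𝓚 (Sum.inl w₀)) = 2 := natCard_kummerSelmerStructure_inl_eq_two_of_isReal W hw₀ hΔ'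
  -- the relaxed and strict groups at `∞`; `Str = Sel₂(W)`, `[R : Str] = 2`
  let S' : Finset (Place ℚ) := {(Sum.inl w₀ : Place ℚ)}
  have hS' : ∀ v : Place ℚ, v ∈ S' ↔ v = Sum.inl w₀ := fun v ↦ by simp [S']
  have hStr : ∀ c, c ∈ (kummerStrict W 2 S').selmerGroup ↔ c ∈ 𝓚.selmerGroup := by
    intro c
    rw [SelmerStructure.mem_selmerGroup_iff, SelmerStructure.mem_selmerGroup_iff]
    constructor
    · intro h v
      by_cases hv : v ∈ S'
      · have h' := h v
        rw [kummerStrict_of_mem W 2 S' hv, AddSubgroup.mem_bot] at h'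
        rw [h']
        exact zero_mem _
      · have h' := h v
        rwa [kummerStrict_of_not_mem W 2 S' hv] at h'
    · intro h v
      by_cases hv : v ∈ S'
      · rw [kummerStrict_of_mem W 2 S' hv, AddSubgroup.mem_bot, (hS' v).mp hv]
        exact hstrictinf c ((𝓚.mem_selmerGroup_iff c).mpr h)
      · rw [kummerStrict_of_not_mem W 2 S' hv]
        exact h v
  have hRfin : ∀ c, c ∈ (kummerRelaxed W 2 S').selmerGroup → ∀ v : HeightOneSpectrum (𝓞 ℚ),
      galoisCohomology.localization (W.torsionGaloisModule ((2 : ℕ) : ℤ)) (Sum.inr v) 1 c ∈ 𝓚 (Sum.inr v) := by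
    intro c hc v
    have h' := (SelmerStructure.mem_selmerGroup_iff _ c).mp hc (Sum.inr v)
    rwa [kummerRelaxed_of_not_mem W 2 S' (by simp [S'])] at h'
  have hKR : 𝓚.selmerGroup ≤ (kummerRelaxed W 2 S').selmerGroup := by
    intro c hc
    refine (SelmerStructure.mem_selmerGroup_iff _ c).mpr fun v ↦ ?_
    by_cases hv : v ∈ S'
    · rw [kummerRelaxed_of_mem W 2 S' hv]; exact AddSubgroup.mem_top _
    · rw [kummerRelaxed_of_not_mem W 2 S' hv]; exact (𝓚.mem_selmerGroup_iff c).mp hc v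
  have hidx : ((kummerStrict W 2 S').selmerGroup).relIndex (kummerRelaxed W 2 S').selmerGroup = 2 := by
    rw [relIndex_kummerStrict_kummerRelaxed_singleton_inl_eq_of_facts W 2 Nat.prime_two.isPrimePow
      (poitouTate_selmerStructure_duality_real_holds ℚ) (forall_localEulerPoincareCharacteristic_adicCompletion ℚ) w₀]
    exact hKinl
  -- a class `c_∞ ∈ R ∖ Sel₂(W)`; `R = Sel₂(W) ⊔ (c_∞ + Sel₂(W))`
  obtain ⟨cinf, hcinfR, hcoset⟩ := (AddSubgroup.relIndex_eq_two_iff).mp hidx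
  have hcinfK : cinf ∉ 𝓚.selmerGroup := by
    intro h
    have h0 := hcoset 0 (zero_mem _)
    rw [zero_add] at h0
    rcases h0 with ⟨-, h0'⟩ | ⟨-, h0'⟩
    · exact h0' (zero_mem _)
    · exact h0' ((hStr cinf).mpr h)
  have h2x : ∀ (x : galoisCohomology (W.torsionGaloisModule ((2 : ℕ) : ℤ)) 1), x + x = 0 := fun x ↦ by
    rw [← two_nsmul]
    exact galoisCohomology.nsmul_eq_zero_of_forall _ (fun T : geomTorsion W ((2 : ℕ) : ℤ) => AddSubgroup.torsionBy.nsmul T) x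
  have h2xv : ∀ (v : Place ℚ) (x : galoisCohomology ((W.torsionGaloisModule ((2 : ℕ) : ℤ)).toLocal v) 1), x + x = 0 := fun v x ↦ by
    rw [← two_nsmul]
    exact galoisCohomology.nsmul_eq_zero_of_forall _ (fun T : geomTorsion W ((2 : ℕ) : ℤ) => AddSubgroup.torsionBy.nsmul T) x
  -- elements of `R` off `Sel₂(W)` are `c_∞` and `c_∞ + g₀`
  have hRel : ∀ c ∈ (kummerRelaxed W 2 S').selmerGroup, c ∉ 𝓚.selmerGroup → c = cinf ∨ c = cinf + g₀ := by
    intro c hc hcK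
    have hsum : c + cinf ∈ 𝓚.selmerGroup := by
      rcases hcoset c hc with ⟨h1, -⟩ | ⟨h2, -⟩
      · exact (hStr _).mp h1
      · exact absurd ((hStr c).mp h2) hcK
    rcases hKel _ hsum with h0 | h1
    · left
      calc c = c + (cinf + cinf) := by rw [h2x, add_zero]
        _ = (c + cinf) + cinf := by rw [add_assoc]
        _ = cinf := by rw [h0, zero_add]
    · right
      calc c = c + (cinf + cinf) := by rw [h2x, add_zero]
        _ = (c + cinf) + cinf := by rw [add_assoc]
        _ = cinf + g₀ := by rw [h1, add_comm]
  -- the bit function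
  refine ⟨fun q ↦ ∀ v : HeightOneSpectrum (𝓞 ℚ), (q : 𝓞 ℚ) ∈ v.asIdeal →
    galoisCohomology.localization (W.torsionGaloisModule ((2 : ℕ) : ℤ)) (Sum.inr v) 1 cinf ≠ 0, ?_⟩
  intro d q₀ q₁ _ _ hadm
  have hd := hadm
  obtain ⟨hdneg, hsf, hd8, hq₀, hq₁, hne, hq₀d, hq₁d, hjac₀, hjac₁, hprimes, -⟩ := hadm
  -- the places of the two door primes
  have hplace : ∀ {q : ℕ} (hq : q.Prime), ∃ v : HeightOneSpectrum (𝓞 ℚ), (q : 𝓞 ℚ) ∈ v.asIdeal := fun {q} hq ↦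
    ⟨primesEquiv.symm ⟨q, hq⟩, by
      have h := Rat.HeightOneSpectrum.natCast_natGenerator_mem (primesEquiv.symm ⟨q, hq⟩)
      rwa [show natGenerator (primesEquiv.symm ⟨q, hq⟩) = q from
        congrArg Subtype.val (primesEquiv.apply_symm_apply (⟨q, hq⟩ : Nat.Primes))] at h⟩
  obtain ⟨v₀, hv₀⟩ := hplace hq₀
  obtain ⟨v₁, hv₁⟩ := hplace hq₁
  have huniq : ∀ {q : ℕ} (hq : q.Prime) {v v' : HeightOneSpectrum (𝓞 ℚ)}, (q : 𝓞 ℚ) ∈ v.asIdeal → (q : 𝓞 ℚ) ∈ v'.asIdeal →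
      v = v' := fun {q} hq {v v'} hv hv' ↦
    primesEquiv.injective (Subtype.ext ((primesEquiv_eq hq hv).trans (primesEquiv_eq hq hv').symm))
  obtain ⟨hq₀2, hq₀Δ, h2v₀, -, -, ht₀⟩ :=
    transposition_place_facts W hsf hd8 hq₀d ((hprimes q₀ hq₀ hq₀d).1 inferInstance) hjac₀ hv₀
  obtain ⟨hq₁2, hq₁Δ, h2v₁, -, -, ht₁⟩ :=
    transposition_place_facts W hsf hd8 hq₁d ((hprimes q₁ hq₁ hq₁d).1 inferInstance) hjac₁ hv₁
  have hKinr : ∀ {v : HeightOneSpectrum (𝓞 ℚ)}, ((2 : ℕ) : 𝓞 ℚ) ∉ v.asIdeal →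
      Nat.card (nsmulAddMonoidHom 2 : (W.baseChange (v.adicCompletion ℚ)).toAffine.Point →+ _).ker = 2 →
      Nat.card (𝓚 (Sum.inr v)) = 2 := fun {v} h2v ht ↦ by
    rw [h𝓚, W.natCard_kummerSelmerStructure_inr v two_ne_zero, natCard_quotient_span_natCast_eq_one_of_not_mem v h2v, mul_one]
    exact ht
  -- the bits: `p_i = [loc_{v_i} g₀ ≠ 0] ↔ MeetsNonNormAt W q_i`, `b_i = [loc_{v_i} c_∞ ≠ 0] ↔ b q_i`
  have hp : ∀ {q : ℕ} [Fact q.Prime] {v : HeightOneSpectrum (𝓞 ℚ)}, (q : 𝓞 ℚ) ∈ v.asIdeal → q ≠ 2 →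
      ¬ (q : ℤ) ∣ minimalDiscriminantInt W →
      (MeetsNonNormAt W q ↔ galoisCohomology.localization (W.torsionGaloisModule ((2 : ℕ) : ℤ)) (Sum.inr v) 1 g₀ ≠ 0) := by
    intro q _ v hqv hq2 hqΔ
    constructor
    · intro h
      obtain ⟨c, hc, hne⟩ := exists_mem_selmerGroup_localization_ne_zero_of_meetsNonNormAt W v hqv hq2 hqΔ h
      have hc0 : c ≠ 0 := by rintro rfl; exact hne (map_zero _)
      rwa [(hKel c hc).resolve_left hc0] at hne
    · intro hne
      by_contra h
      exact hne (forall_mem_selmerGroup_localization_eq_zero_of_not_meetsNonNormAt W v hqv hq2 hqΔ hSha h g₀ hg₀)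
  have hb : ∀ {q : ℕ} (hq : q.Prime) {v : HeightOneSpectrum (𝓞 ℚ)}, (q : 𝓞 ℚ) ∈ v.asIdeal →
      ((∀ v' : HeightOneSpectrum (𝓞 ℚ), (q : 𝓞 ℚ) ∈ v'.asIdeal →
        galoisCohomology.localization (W.torsionGaloisModule ((2 : ℕ) : ℤ)) (Sum.inr v') 1 cinf ≠ 0) ↔
        galoisCohomology.localization (W.torsionGaloisModule ((2 : ℕ) : ℤ)) (Sum.inr v) 1 cinf ≠ 0) :=
    fun {q} hq {v} hqv ↦ ⟨fun h ↦ h v hqv, fun h v' hv' ↦ by rw [huniq hq hv' hqv]; exact h⟩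
  -- in a local line `{0, k}`: `a + b = 0 ↔ (a ≠ 0 ↔ b ≠ 0)`
  have hline : ∀ (v : Place ℚ) (a b : galoisCohomology ((W.torsionGaloisModule ((2 : ℕ) : ℤ)).toLocal v) 1),
      a ∈ 𝓚 v → b ∈ 𝓚 v → Nat.card (𝓚 v) = 2 → (a + b = 0 ↔ (a ≠ 0 ↔ b ≠ 0)) := by
    intro v a b ha hb hcard
    obtain ⟨k, -, hk0, hel⟩ := exists_ne_zero_of_natCard_eq_two (𝓚 v) hcard
    rcases hel a ha with rfl | rfl <;> rcases hel b hb with rfl | rfl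
    · exact ⟨fun _ ↦ Iff.rfl, fun _ ↦ add_zero 0⟩
    · exact ⟨fun h ↦ absurd (by rwa [zero_add] at h) hk0, fun h ↦ ((h.mpr hk0) rfl).elim⟩
    · exact ⟨fun h ↦ absurd (by rwa [add_zero] at h) hk0, fun h ↦ ((h.mp hk0) rfl).elim⟩
    · exact ⟨fun _ ↦ Iff.rfl, fun _ ↦ h2xv v _⟩
  dsimp only
  rw [hp hv₀ hq₀2 hq₀Δ, hp hv₁ hq₁2 hq₁Δ, hb hq₁ hv₁, hb hq₀ hv₀]
  -- the four local bits
  set P₀ : Prop := galoisCohomology.localization (W.torsionGaloisModule ((2 : ℕ) : ℤ)) (Sum.inr v₀) 1 g₀ ≠ 0 with hP₀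
  set P₁ : Prop := galoisCohomology.localization (W.torsionGaloisModule ((2 : ℕ) : ℤ)) (Sum.inr v₁) 1 g₀ ≠ 0 with hP₁
  set B₀ : Prop := galoisCohomology.localization (W.torsionGaloisModule ((2 : ℕ) : ℤ)) (Sum.inr v₀) 1 cinf ≠ 0 with hB₀
  set B₁ : Prop := galoisCohomology.localization (W.torsionGaloisModule ((2 : ℕ) : ℤ)) (Sum.inr v₁) 1 cinf ≠ 0 with hB₁
  rw [← xor_and_iff_independent]
  -- the local values of `c_∞ + g₀`
  have hsum₀ : galoisCohomology.localization (W.torsionGaloisModule ((2 : ℕ) : ℤ)) (Sum.inr v₀) 1 (cinf + g₀) = 0 ↔ (B₀ ↔ P₀) := by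
    rw [map_add]
    exact hline _ _ _ (hRfin cinf hcinfR v₀) (hRfin g₀ (hKR hg₀) v₀) (hKinr h2v₀ ht₀)
  have hsum₁ : galoisCohomology.localization (W.torsionGaloisModule ((2 : ℕ) : ℤ)) (Sum.inr v₁) 1 (cinf + g₀) = 0 ↔ (B₁ ↔ P₁) := by
    rw [map_add]
    exact hline _ _ _ (hRfin cinf hcinfR v₁) (hRfin g₀ (hKR hg₀) v₁) (hKinr h2v₁ ht₁)
  have hcg0 : cinf + g₀ ≠ 0 := by
    intro h
    apply hcinfK
    have : cinf = g₀ := by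
      calc cinf = cinf + (g₀ + g₀) := by rw [h2x, add_zero]
        _ = (cinf + g₀) + g₀ := by rw [add_assoc]
        _ = g₀ := by rw [h, zero_add]
    rw [this]; exact hg₀
  have hcinf0 : cinf ≠ 0 := fun h ↦ hcinfK (h ▸ zero_mem _)
  by_cases hdoor : MeetsNonNormAt W q₀ ∨ MeetsNonNormAt W q₁
  · -- a door is open: the quadratic `iff` decides
    rw [twoTranspositionTwistLaw_iff_strict W hΔ hT hrank hSha hegg d q₀ q₁ hd v₀ v₁ hv₀ hv₁ hdoor]
    have hP : ¬ (¬ P₀ ∧ ¬ P₁) := by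
      rw [hp hv₀ hq₀2 hq₀Δ, hp hv₁ hq₁2 hq₁Δ] at hdoor
      rintro ⟨h0, h1⟩
      rcases hdoor with h | h
      · exact h0 h
      · exact h1 h
    constructor
    · intro hbot
      have hstrict : ∀ c ∈ (kummerRelaxed W 2 S').selmerGroup,
          galoisCohomology.localization (W.torsionGaloisModule ((2 : ℕ) : ℤ)) (Sum.inr v₀) 1 c = 0 →
          galoisCohomology.localization (W.torsionGaloisModule ((2 : ℕ) : ℤ)) (Sum.inr v₁) 1 c = 0 → c = 0 := by
        intro c hc h0 h1
        have hmem := hbot.le (AddSubgroup.mem_inf.mpr ⟨AddSubgroup.mem_inf.mpr ⟨hc, (AddMonoidHom.mem_ker).mpr h0⟩,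
          (AddMonoidHom.mem_ker).mpr h1⟩)
        exact (AddSubgroup.mem_bot).mp hmem
      refine ⟨hP, ?_, ?_⟩
      · rintro ⟨hb0, hb1⟩
        exact hcinf0 (hstrict cinf hcinfR (not_not.mp hb0) (not_not.mp hb1))
      · intro hbp
        exact hcg0 (hstrict (cinf + g₀) (add_mem hcinfR (hKR hg₀)) (hsum₀.mpr hbp.1) (hsum₁.mpr hbp.2))
    · rintro ⟨-, hB, hBP⟩
      rw [eq_bot_iff]
      intro c hc
      have hcR := (AddSubgroup.mem_inf.mp (AddSubgroup.mem_inf.mp hc).1).1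
      have hc0 := (AddMonoidHom.mem_ker).mp (AddSubgroup.mem_inf.mp (AddSubgroup.mem_inf.mp hc).1).2
      have hc1 := (AddMonoidHom.mem_ker).mp (AddSubgroup.mem_inf.mp hc).2
      rw [AddSubgroup.mem_bot]
      by_cases hcK : c ∈ 𝓚.selmerGroup
      · rcases hKel c hcK with h | h
        · exact h
        · exfalso
          rw [h] at hc0 hc1
          exact hP ⟨not_not.mpr hc0, not_not.mpr hc1⟩
      · exfalso
        rcases hRel c hcR hcK with h | h
        · rw [h] at hc0 hc1
          exact hB ⟨not_not.mpr hc0, not_not.mpr hc1⟩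
        · rw [h] at hc0 hc1
          exact hBP ⟨hsum₀.mp hc0, hsum₁.mp hc1⟩
  · -- both doors shut: `#Sel₂(W^{(d)}) ∈ {4, 16}` and no door bit is set
    have hP₀' : ¬ P₀ := fun h ↦ hdoor (Or.inl ((hp hv₀ hq₀2 hq₀Δ).mpr h))
    have hP₁' : ¬ P₁ := fun h ↦ hdoor (Or.inr ((hp hv₁ hq₁2 hq₁Δ).mpr h))
    have hshut := (twoTranspositionTwistLaw_card W hΔ hT hrank hSha hegg d q₀ q₁ hd).2
      (fun h ↦ hdoor (Or.inl h)) (fun h ↦ hdoor (Or.inr h))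
    constructor
    · intro h1
      exfalso
      rcases hshut with h | h <;> omega
    · rintro ⟨h, -, -⟩
      exact absurd ⟨hP₀', hP₁'⟩ h

end Summit.BirchSwinnertonDyer.BirchSwinnertonDyer.Theorems.GenusKolyTransp

end
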